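import Summits.AtomisticToContinuum.HydrodynamicLimit.Theses.LambertianContactSwap
import Summits.AtomisticToContinuum.HydrodynamicLimit.Theses.TwoClocks
import Summits.AtomisticToContinuum.HydrodynamicLimit.Theses.JaynesSqueeze
import HarnessLib

/-!
# Sketch — crux idea `matched-reference-course-transfer` (crux stmt-AtomisticToContinuum-12097,
# `LambertianContactSwap.ContactAngleEquidistribution`; crux-ideate round 2, ideator 4)

Typed objects of the idea card (statements only; the two elementary lemmas are proved, the three
claimed theorems of the line are recorded as `sorry`ed SHAPES — this file is a sketch, not a skeleton):

* `ContactAngleEquidistributionPreShock` — the crux's conclusion under the quantifier prefix of the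
  consuming item `SwapGap` (classical hs-Euler solution on `[0,T)`, tie at `t = 0`, `t ∈ [0,T)`): the part
  of the crux that the route's layer-2 (`SwapGap ⇐ ContactAngleEquidistribution → LinearResponse`) uses.
* `ThinShellTightness` — the NEW typed stub of the line: the `|g|²`-weighted, speed-capped share of
  collisions having a third centre in the thin shell `ε ≤ dist ≤ (1+δ)ε` of the colliding pair vanishes as
  `δ → 0`, uniformly in `N` (a 3-body analogue of the evolved shell bound `hShell` to which item 12102 was
  reduced, `collisionMomentBound_of_shellFluxBound`).
* `entropyTransfer_shape` — the abstract two-sided entropy (Donsker–Varadhan) transfer at an `o(N)` budget.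
* `dist_le_of_prompt` — the kinematic lemma behind the course sandwich: a collision of `(i,j)` that is
  preceded within time `h` by a hit on `i` or `j` sees, at the instant of that hit, the partner within
  `ε + 2Vh` (thin shell), for speeds `≤ V`.
* `preShock_of_crux` (proved), `preShock_of_relEntropyVanishing`, `preShock_of_hydrodynamicLimit` (shapes).
-/

noncomputable section

namespace Summit.AtomisticToContinuum.HydrodynamicLimit.Cruxes.ContactAngleEquidistribution.MatchedReferenceCourseTransfer

open MeasureTheory Filter Set Topology InformationTheory
open scoped ENNReal Classical
open Literature.MathematicalPhysics.KineticTheory Literature.Analysis.FluidPDE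
open Summit.AtomisticToContinuum.HydrodynamicLimit.Theses
open Summit.AtomisticToContinuum.HydrodynamicLimit.Theses.LambertianContactSwap

/-- The crux's conclusion restricted to the quantifier prefix of `SwapGap`: pre-shock times of a classical
hard-sphere-Euler solution tied to the local Gibbs data at `t = 0`. [this sketch] -/
def ContactAngleEquidistributionPreShock : Prop :=
  let Cfg : ℕ → Type := fun N => Config (N + 1) (Fin 3) T3; let G := Torus.geometry (Fin 3); let ε : ℝ → ℕ → ℝ := hsDiameter; let τ : ℝ → (N : ℕ) → Cfg N → ENNReal := fun σ N z => Alexander.freeExitTime G (ε σ N) z; let S : ℝ → (N : ℕ) → Cfg N → Cfg N := fun t _ z => freeFlight G t z; let ldir : V3 → V3 → V3 := fun ω ξ => ‖‖ω‖⁻¹ • ω + ‖ξ‖⁻¹ • ξ‖⁻¹ • (‖ω‖⁻¹ • ω + ‖ξ‖⁻¹ • ξ); let zpre : ℝ → (N : ℕ) → Cfg N → ℕ → Cfg N := fun σ N z m => let y := Alexander.stateAfter G (ε σ N) z m; S (τ σ N y).toReal N y; let Kt : ℝ → (N : ℕ) → Cfg N → ℝ → ℕ := fun σ N z t => Alexander.collisionCount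 G (ε σ N) z t; let hit : ℝ → (N : ℕ) → Cfg N → Fin (N + 1) → Fin (N + 1) → Prop := fun σ N y i j => i < j ∧ y ∈ contactSet G (N + 1) (ε σ N) i j ∧ IsIncoming G y i j; let tcol : ℝ → (N : ℕ) → Cfg N → ℕ → ℝ := fun σ N z m => (Alexander.collisionInstant G (ε σ N) z (m + 1)).toReal; let xmid : (N : ℕ) → Cfg N → Fin (N + 1) → Fin (N + 1) → T3 := fun _ y i j => G.translate (y j).1 ((2 : ℝ)⁻¹ • G.sepVec (y i).1 (y j).1); ∀ (a₀ θ₀ : T3 → ℝ) (u₀ : T3 → V3), Continuous a₀ → Continuous θ₀ → Continuous u₀ → (∀ x, 0 < a₀ x) → (∀ x, 0 < θ₀ x) → ∃ σ₀ : ℝ, 0 < σ₀ ∧ ∀ σ : ℝ, 0 < σ → σ < σ₀ → ∀ (T : ℝ) (ρ θ : ℝ → T3 → ℝ) (u : ℝ → T3 → V3), IsHardSphereEulerSolution σ T ρ u θ → ∀ Φ : (N : ℕ) → HardSphereFlow G (ε σ N) (N + 1), let P := fun N => localGibbsLaw σ a₀ u₀ θ₀ N (Φ N); TendstoHydroFieldsAt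 P Φ ρ u θ 0 → ∀ t ∈ Set.Ico 0 T, ∀ ψ : ℕ → ℝ → T3 → V3 → V3 → V3 → ℝ, (∀ N, Measurable (fun p : ℝ × T3 × V3 × V3 × V3 => ψ N p.1 p.2.1 p.2.2.1 p.2.2.2.1 p.2.2.2.2)) → (∀ N s x v w n, |ψ N s x v w n| ≤ 1) → (∀ N s x v w (n n' : V3), ‖n‖ = 1 → ‖n'‖ = 1 → |ψ N s x v w n - ψ N s x v w n'| ≤ ‖n - n'‖) → Tendsto (fun N : ℕ => ∫ z, ((N : ℝ) + 1) ^ (-(4 / 3 : ℝ)) * ∑ m ∈ Finset.range (Kt σ N z t), ∑ i : Fin (N + 1), ∑ j : Fin (N + 1), (let y := zpre σ N z m; if hit σ N y i j then ‖(y i).2 - (y j).2‖ ^ 2 * (ψ N (tcol σ N z m) (xmid N y i j) (y i).2 (y j).2 ((ε σ N)⁻¹ • G.sepVec (y i).1 (y j).1) - ∫ ξ, ψ N (tcol σ N z m) (xmid N y i j) (y i).2 (y j).2 (ldir (-((y i).2 - (y j).2)) ξ) ∂(ProbabilityTheory.stdGaussian V3)) else 0) ∂(P N)) atTop (nhds 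0)

/-- **THIN-SHELL TIGHTNESS** (the new stub of the line). For local Gibbs data, small `σ`, every flow family,
horizon `t ≥ 0` and speed cap `V`: the normalised `|g|²`-weighted number of speed-capped collisions of the
deterministic gas whose colliding pair `(i,j)` has, at the collision instant, a THIRD centre within
`(1+δ)ε` of `xᵢ` or of `xⱼ`, has `limsup_N` tending to `0` as `δ → 0⁺`. Equilibrium value `≍ σ³δ` (Campbell);
out of equilibrium it is a 3-body evolved-shell bound of the class of the hypothesis `hShell` of
`collisionMomentBound_of_shellFluxBound` (item 12102). [this sketch] -/
def ThinShellTightness : Prop :=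
  let Cfg : ℕ → Type := fun N => Config (N + 1) (Fin 3) T3; let G := Torus.geometry (Fin 3); let ε : ℝ → ℕ → ℝ := hsDiameter; let τ : ℝ → (N : ℕ) → Cfg N → ENNReal := fun σ N z => Alexander.freeExitTime G (ε σ N) z; let S : ℝ → (N : ℕ) → Cfg N → Cfg N := fun t _ z => freeFlight G t z; let zpre : ℝ → (N : ℕ) → Cfg N → ℕ → Cfg N := fun σ N z m => let y := Alexander.stateAfter G (ε σ N) z m; S (τ σ N y).toReal N y; let Kt : ℝ → (N : ℕ) → Cfg N → ℝ → ℕ := fun σ N z t => Alexander.collisionCount G (ε σ N) z t; let hit : ℝ → (N : ℕ) → Cfg N → Fin (N + 1) → Fin (N + 1) → Prop := fun σ N y i j => i < j ∧ y ∈ contactSet G (N + 1) (ε σ N) i j ∧ IsIncoming G y i j; let thin : ℝ → ℝ → (N : ℕ) → Cfg N → Fin (N + 1) → Fin (N + 1) → Prop := fun δ σ N y i j => ∃ k : Fin (N + 1), k ≠ i ∧ k ≠ j ∧ (‖G.sepVec (y k).1 (y i).1‖ ≤ (1 + δ) * ε σ N ∨ ‖G.sepVec (y k).1 (y j).1‖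 ≤ (1 + δ) * ε σ N); ∀ (a₀ θ₀ : T3 → ℝ) (u₀ : T3 → V3), Continuous a₀ → Continuous θ₀ → Continuous u₀ → (∀ x, 0 < a₀ x) → (∀ x, 0 < θ₀ x) → ∃ σ₀ : ℝ, 0 < σ₀ ∧ ∀ σ : ℝ, 0 < σ → σ < σ₀ → ∀ Φ : (N : ℕ) → HardSphereFlow G (ε σ N) (N + 1), let P := fun N => localGibbsLaw σ a₀ u₀ θ₀ N (Φ N); ∀ t : ℝ, 0 ≤ t → ∀ V : ℝ, 0 < V → Tendsto (fun δ : ℝ => Filter.limsup (fun N : ℕ => ∫⁻ z, ENNReal.ofReal (((N : ℝ) + 1) ^ (-(4 / 3 : ℝ)) * ∑ m ∈ Finset.range (Kt σ N z t), ∑ i : Fin (N + 1), ∑ j : Fin (N + 1), (let y := zpre σ N z m; if hit σ N y i j ∧ thin δ σ N y i j ∧ ‖(y i).2‖ ≤ V ∧ ‖(y j).2‖ ≤ V then (1 : ℝ) else 0)) ∂(P N)) atTop) (𝓝[>] 0) (𝓝 0)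

/-! ### The two elementary lemmas of the mechanism -/

/-- **Abstract two-sided entropy transfer at budget `H`** (Donsker–Varadhan / entropy inequality, the
shape the line uses at EACH fixed time with `H = KL(P_s ‖ LG^E_s) = o(N)`): if the centred exponential
moments of `X` under the reference `Q` are `≤ exp(C l²)` for `|l| ≤ l₀`, then for every admissible tilt
`0 < l ≤ l₀`, `|E_P X − E_Q X| ≤ H/l + C l` where `H ≥ KL(P‖Q)`. (Optimising, `≤ 2√(C H)` once
`√(H/C) ≤ l₀`.) Statement only. [cite: KipnisLandim1999, App. 1 §8] -/
theorem entropyTransfer_shape {Ω : Type*} [MeasurableSpace Ω] (P Q : Measure Ω) [IsProbabilityMeasure P]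
    [IsProbabilityMeasure Q] (X : Ω → ℝ) (hX : Measurable X) (hPX : Integrable X P) (hQX : Integrable X Q)
    (C l₀ H : ℝ) (hl₀ : 0 < l₀) (hH : klDiv P Q ≤ ENNReal.ofReal H)
    (hmgf : ∀ l : ℝ, |l| ≤ l₀ → ∫ ω, Real.exp (l * (X ω - ∫ ω', X ω' ∂Q)) ∂Q ≤ Real.exp (C * l ^ 2)) :
    ∀ l : ℝ, 0 < l → l ≤ l₀ → |(∫ ω, X ω ∂P) - ∫ ω, X ω ∂Q| ≤ H / l + C * l := by
  sorry

/-- **Thin-shell localisation of prompt collisions** (Euclidean model of the torus statement, valid inside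
one chart): if `i` sits at contact with `k` at time `u` (`‖xᵢ − x_k‖ = ε`), and after a common free flight of
duration `s ∈ [0, h]` with speeds `≤ V` the pair `(i, j)` is at contact, then ALREADY at time `u` the partner
`j` is within `ε + 2Vh` of `i`: the hit `(i,k)` is a collision with a third centre in the thin shell of `i`.
[this sketch] -/
theorem dist_le_of_prompt {E : Type*} [NormedAddCommGroup E] [NormedSpace ℝ E] (xi xj vi vj : E)
    {ε h V s : ℝ} (hs0 : 0 ≤ s) (hsh : s ≤ h) (hV : 0 ≤ V) (hvi : ‖vi‖ ≤ V) (hvj : ‖vj‖ ≤ V)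
    (hcoll : ‖(xi + s • vi) - (xj + s • vj)‖ = ε) : ‖xi - xj‖ ≤ ε + 2 * V * h := by
  have hdecomp : xi - xj = ((xi + s • vi) - (xj + s • vj)) - s • (vi - vj) := by
    simp only [smul_sub]; abel
  calc ‖xi - xj‖ = ‖((xi + s • vi) - (xj + s • vj)) - s • (vi - vj)‖ := by rw [hdecomp]
    _ ≤ ‖(xi + s • vi) - (xj + s • vj)‖ + ‖s • (vi - vj)‖ := norm_sub_le _ _
    _ = ε + s * ‖vi - vj‖ := by rw [hcoll, norm_smul, Real.norm_of_nonneg hs0]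
    _ ≤ ε + s * (2 * V) := by
        gcongr
        calc ‖vi - vj‖ ≤ ‖vi‖ + ‖vj‖ := norm_sub_le _ _
          _ ≤ V + V := add_le_add hvi hvj
          _ = 2 * V := by ring
    _ ≤ ε + h * (2 * V) := by gcongr
    _ = ε + 2 * V * h := by ring

/-! ### The crux dominates its pre-shock restriction (proved) -/

/-- The crux as filed (`∀ t ≥ 0`, no Euler solution) implies its pre-shock restriction (ignore the Euler
data and the tie). [this sketch] -/
theorem preShock_of_crux (h : ContactAngleEquidistribution) : ContactAngleEquidistributionPreShock := by
  intro a₀ θ₀ u₀ ha hθ hu ha0 hθ0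
  obtain ⟨σ₀, hσ₀, H⟩ := h a₀ θ₀ u₀ ha hθ hu ha0 hθ0
  refine ⟨σ₀, hσ₀, fun σ hσ hσlt T ρ θ u _hE Φ _htie t ht => ?_⟩
  exact H σ hσ hσlt Φ t ht.1

/-! ### The claimed theorems of the line (SHAPES — the card's content, not proved here) -/

/-- **STATIC COURSE TRANSFER (claimed, the card's provable theorem modulo statics)**: Yau's form of the
conjunct pre-shock (shared target `TwoClocks.RelEntropyVanishing`, stmt-0766) + thin-shell tightness + the
cubic collision-moment bound (item 12102) give the pre-shock crux. Mechanism: fixed-window collision-course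
sandwich (pathwise, `dist_le_of_prompt` + kissing number) ⟹ instantaneous thin-shell observables ⟹
entropy transfer at the Euler-driven reference with budget `o(N)` (`entropyTransfer_shape` + canonical
cluster-expansion MGF) ⟹ cosine law of the reference flux (statics, `eq_contactAngleEquidistribution_const`
technology). [this sketch] -/
theorem preShock_of_relEntropyVanishing (hRE : TwoClocks.RelEntropyVanishing) (hThin : ThinShellTightness)
    (hTail : CollisionMomentBound) (hLDA : JaynesSqueeze.HardSphereLDA) (hEos : JaynesSqueeze.HsEosLowDensity)
    (hD : JaynesSqueeze.DiluteSelfConsistency) : ContactAngleEquidistributionPreShock := by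
  sorry

/-- **NECESSITY (claimed corollary)**: with the landed bookkeeping `klCore_of_meanFieldsConverge` and
`meanHydroLimitInBand_of_hydrodynamicLimit`, the conjunct itself implies the pre-shock crux modulo the two
tightness items and the JaynesSqueeze statics — so a refutation of the crux at a pre-shock time refutes
`HydrodynamicLimit`. [this sketch] -/
theorem preShock_of_hydrodynamicLimit (hHL : _root_.HydrodynamicLimit) (hThin : ThinShellTightness)
    (hTail : CollisionMomentBound) (hLDA : JaynesSqueeze.HardSphereLDA) (hEos : JaynesSqueeze.HsEosLowDensity)
    (hD : JaynesSqueeze.DiluteSelfConsistency) : ContactAngleEquidistributionPreShock := by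
  sorry

end Summit.AtomisticToContinuum.HydrodynamicLimit.Cruxes.ContactAngleEquidistribution.MatchedReferenceCourseTransfer
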